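import Summits.AtomisticToContinuum.Crystallization.Theorems.FrustratedLawDichotomyCellArithGram
import Summits.AtomisticToContinuum.Crystallization.Theorems.FrustratedLawDichotomyCellArithTails

/-!
# FrustratedLawDichotomy · crux `AperiodicFrustratedLawGap` (stmt-AtomisticToContinuum-27623) — CELL-ARITH, the PER-LABEL columns
# packaged (decomp-a2c hand-1 g53): the NASH residual box of (252) `nashVecLab` as finite sums of `linLab` readings, the host-force
# pairing column `hf`, and the remainder pair term of `RM` — the readings the ≈ 4.6 k labels of N9′-FCC54's N₁ (labels with an
# interior neighbour; critic r1777 (A), lens-5 REPLY l.9376 (1)) need, stated over (252)'s OWN finite sets so no list layout is fixed here.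

* §1 ★ `nashLoZ`/`nashHiZ` — coordinate `i` of `nashVecLab G M MI a ω nb m` read in `ℤ`: the leading term `ψ(g(a m,a m))·a m i`
  (`smulCoordLo/Hi`), minus the own-multiplier sum over `(M.erase m).filter (· ∈ nb m)` of `linLab G (a m − a m') (ω m)` (present iff
  `m ∈ MI`), plus the neighbours' sum over `(MI.erase m).filter (· ∈ nb m)` of `linLab G (a x − a m) (ω x)`, each summand by
  `linLabLoZ/HiZ` of `…CellArithGram` from per-pair rational windows; `nashLoZ_le`/`le_nashHiZ`.  With `…CellArithGram.norm_posL_le_of_gramHiZ2`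
  and (252) `nashVec_posL` this is the (251) `hnn` entry of such a label.
* §2 ★ `hf_le` — the (251) `hhf` entry: `⟪Y m, Σ_{nbh} g(pos m − pos m')⟫ + ‖Y m‖·psiTail δ Lh ≤ (Σ cornerHi + scHi yb (rdHi S psiTailQ))/S`
  in the Gram frame ((252) `inner_posL_sum_ljBondForce`, `pairing_le_cornerHi`, `…CellArithTails.le_psiTailHiZ`).
* §3 ★ `rmTerm_le` — one summand of the (251) `hRM` column: `a·forceRem r η ≤ scHi yb (forceRemHiZ S rlo rhi η)/S` for `0 ≤ a ≤ yb`,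
  `rlo ≤ r ≤ rhi`, `0 ≤ η < rlo` (the K-file sums these over its `nbr` lists with `le_finsetSum_readings`).

DEF-LIGHT (2 computable defs `nashLoZ`/`nashHiZ`); imports `…CellArithGram`, `…CellArithTails`; 0 sorry.  Tags: [folklore].
-/

namespace Summit.AtomisticToContinuum.Crystallization.Theorems.FrustratedLawDichotomyCellArithNash

open scoped BigOperators
open RealInnerProductSpace
open Summit.AtomisticToContinuum.Crystallization.Theorems.FrustratedLawDichotomyCoherentFloorAlgebra (psiT psiT1 ljBondForce forceRem)
open Summit.AtomisticToContinuum.Crystallization.Theorems.FrustratedLawDichotomyCellTails (psiTail)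
open Summit.AtomisticToContinuum.Crystallization.Theorems.FrustratedLawDichotomyCellMetric
  (posL gram linLab nashVecLab inner_posL_sum_ljBondForce)
open Summit.AtomisticToContinuum.Crystallization.Theorems.FrustratedLawDichotomyCellArith
open Summit.AtomisticToContinuum.Crystallization.Theorems.FrustratedLawDichotomyCellArithLJ
open Summit.AtomisticToContinuum.Crystallization.Theorems.FrustratedLawDichotomyCellArithTaylor
open Summit.AtomisticToContinuum.Crystallization.Theorems.FrustratedLawDichotomyCellArithTails (psiTailQ le_psiTailHiZ)
open Summit.AtomisticToContinuum.Crystallization.Theorems.FrustratedLawDichotomyCellArithGram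

variable {ι : Type*} [DecidableEq ι]

/-! ## §1 The NASH residual box -/

/-- ★ LOWER reading of coordinate `i` of `nashVecLab G M MI a ω nb m` from rational label data `aq ωq` and per-pair rational
windows: `lo0 hi0` for `g(a m, a m)`; for the own-multiplier pairs `m'`: `tlo thi` (window of `g(z,z)`, `z = a m − a m'`) and
`glo ghi` (interval of `g(z, ω m)`); for the neighbour pairs `x`: `tlo' thi'` (`z = a x − a m`) and `glo' ghi'` (`g(z, ω x)`). [folklore] -/
def nashLoZ (S : ℤ) (M MI : Finset ι) (nb : ι → Finset ι) (m : ι) (i : Fin 3) (aq ωq : ι → Fin 3 → ℚ) (lo0 hi0 : ℚ)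
    (tlo thi glo ghi tlo' thi' glo' ghi' : ι → ℚ) : ℤ :=
  smulCoordLo (psiLoZ S lo0 hi0) (psiHiZ S lo0 hi0) (aq m i)
    - (if m ∈ MI then ∑ m' ∈ (M.erase m).filter (fun m' => m' ∈ nb m),
        linLabHiZ S (tlo m') (thi m') (glo m') (ghi m') (ωq m i) (aq m i - aq m' i) else 0)
    + ∑ x ∈ (MI.erase m).filter (fun x => x ∈ nb m), linLabLoZ S (tlo' x) (thi' x) (glo' x) (ghi' x) (ωq x i) (aq x i - aq m i)

/-- ★ UPPER reading of coordinate `i` of `nashVecLab G M MI a ω nb m` (same data). [folklore] -/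
def nashHiZ (S : ℤ) (M MI : Finset ι) (nb : ι → Finset ι) (m : ι) (i : Fin 3) (aq ωq : ι → Fin 3 → ℚ) (lo0 hi0 : ℚ)
    (tlo thi glo ghi tlo' thi' glo' ghi' : ι → ℚ) : ℤ :=
  smulCoordHi (psiLoZ S lo0 hi0) (psiHiZ S lo0 hi0) (aq m i)
    - (if m ∈ MI then ∑ m' ∈ (M.erase m).filter (fun m' => m' ∈ nb m),
        linLabLoZ S (tlo m') (thi m') (glo m') (ghi m') (ωq m i) (aq m i - aq m' i) else 0)
    + ∑ x ∈ (MI.erase m).filter (fun x => x ∈ nb m), linLabHiZ S (tlo' x) (thi' x) (glo' x) (ghi' x) (ωq x i) (aq x i - aq m i)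

section Nash

variable {S : ℤ} {G : Matrix (Fin 3) (Fin 3) ℝ} {M MI : Finset ι} {nb : ι → Finset ι} {m : ι} {i : Fin 3}
  {a ω : ι → Fin 3 → ℝ} {aq ωq : ι → Fin 3 → ℚ} {lo0 hi0 : ℚ} {tlo thi glo ghi tlo' thi' glo' ghi' : ι → ℚ}

/-- ★ THE NASH BOX: `nashLoZ ≤ S·(nashVecLab …) i ≤ nashHiZ` from the window facts of every pair in (252)'s two near sums. [folklore] -/
theorem nash_mem (hS : 0 < S) (ha : ∀ x j, a x j = (aq x j : ℝ)) (hω : ∀ x j, ω x j = (ωq x j : ℝ))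
    (h0 : 0 < lo0) (h01 : (lo0 : ℝ) ≤ gram G (a m) (a m)) (h02 : gram G (a m) (a m) ≤ (hi0 : ℝ))
    (hown : ∀ m' ∈ (M.erase m).filter (fun m' => m' ∈ nb m),
      0 < tlo m' ∧ (tlo m' : ℝ) ≤ gram G (a m - a m') (a m - a m') ∧ gram G (a m - a m') (a m - a m') ≤ (thi m' : ℝ)
        ∧ (glo m' : ℝ) ≤ gram G (a m - a m') (ω m) ∧ gram G (a m - a m') (ω m) ≤ (ghi m' : ℝ))
    (hnbr : ∀ x ∈ (MI.erase m).filter (fun x => x ∈ nb m),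
      0 < tlo' x ∧ (tlo' x : ℝ) ≤ gram G (a x - a m) (a x - a m) ∧ gram G (a x - a m) (a x - a m) ≤ (thi' x : ℝ)
        ∧ (glo' x : ℝ) ≤ gram G (a x - a m) (ω x) ∧ gram G (a x - a m) (ω x) ≤ (ghi' x : ℝ)) :
    ((nashLoZ S M MI nb m i aq ωq lo0 hi0 tlo thi glo ghi tlo' thi' glo' ghi' : ℤ) : ℝ) ≤ S * nashVecLab G M MI a ω nb m i
      ∧ S * nashVecLab G M MI a ω nb m i
        ≤ ((nashHiZ S M MI nb m i aq ωq lo0 hi0 tlo thi glo ghi tlo' thi' glo' ghi' : ℤ) : ℝ) := by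
  -- the leading term
  obtain ⟨L1, L2⟩ := smul_coord_mem (S := S) (G := G) (z := a m) (zq := aq m) (i := i) hS h0 h01 h02 (ha m i)
  -- coordinates of the label differences are the rational differences
  have hsub : ∀ x y : ι, (a x - a y) i = ((aq x i - aq y i : ℚ) : ℝ) := by
    intro x y; simp only [Pi.sub_apply, ha]; push_cast; ring
  -- own-multiplier sum
  have A1 : ∀ m' ∈ (M.erase m).filter (fun m' => m' ∈ nb m),
      ((linLabLoZ S (tlo m') (thi m') (glo m') (ghi m') (ωq m i) (aq m i - aq m' i) : ℤ) : ℝ) ≤ S * linLab G (a m - a m') (ω m) i := by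
    intro m' hm'
    obtain ⟨t0, t1, t2, g1, g2⟩ := hown m' hm'
    exact linLabLoZ_le (yq := ωq m) (zq := fun j => aq m j - aq m' j) hS t0 t1 t2 g1 g2 (hω m i) (hsub m m')
  have A2 : ∀ m' ∈ (M.erase m).filter (fun m' => m' ∈ nb m),
      S * linLab G (a m - a m') (ω m) i ≤ ((linLabHiZ S (tlo m') (thi m') (glo m') (ghi m') (ωq m i) (aq m i - aq m' i) : ℤ) : ℝ) := by
    intro m' hm'
    obtain ⟨t0, t1, t2, g1, g2⟩ := hown m' hm'
    exact le_linLabHiZ (yq := ωq m) (zq := fun j => aq m j - aq m' j) hS t0 t1 t2 g1 g2 (hω m i) (hsub m m')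
  -- neighbours' sum
  have B1 : ∀ x ∈ (MI.erase m).filter (fun x => x ∈ nb m),
      ((linLabLoZ S (tlo' x) (thi' x) (glo' x) (ghi' x) (ωq x i) (aq x i - aq m i) : ℤ) : ℝ) ≤ S * linLab G (a x - a m) (ω x) i := by
    intro x hx
    obtain ⟨t0, t1, t2, g1, g2⟩ := hnbr x hx
    exact linLabLoZ_le (yq := ωq x) (zq := fun j => aq x j - aq m j) hS t0 t1 t2 g1 g2 (hω x i) (hsub x m)
  have B2 : ∀ x ∈ (MI.erase m).filter (fun x => x ∈ nb m),
      S * linLab G (a x - a m) (ω x) i ≤ ((linLabHiZ S (tlo' x) (thi' x) (glo' x) (ghi' x) (ωq x i) (aq x i - aq m i) : ℤ) : ℝ) := by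
    intro x hx
    obtain ⟨t0, t1, t2, g1, g2⟩ := hnbr x hx
    exact le_linLabHiZ (yq := ωq x) (zq := fun j => aq x j - aq m j) hS t0 t1 t2 g1 g2 (hω x i) (hsub x m)
  have SA1 := finsetSum_readings_le S _ _ _ A1
  have SA2 := le_finsetSum_readings S _ _ _ A2
  have SB1 := finsetSum_readings_le S _ _ _ B1
  have SB2 := le_finsetSum_readings S _ _ _ B2
  -- expand the coordinate of nashVecLab
  have e : nashVecLab G M MI a ω nb m i = (psiT (gram G (a m) (a m)) • a m) i
      - (if m ∈ MI then ∑ m' ∈ (M.erase m).filter (fun m' => m' ∈ nb m), linLab G (a m - a m') (ω m) i else 0)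
      + ∑ x ∈ (MI.erase m).filter (fun x => x ∈ nb m), linLab G (a x - a m) (ω x) i := by
    unfold nashVecLab
    by_cases h : m ∈ MI
    · simp [h, Finset.sum_apply]; ring
    · simp [h, Finset.sum_apply]
  rw [e]
  unfold nashLoZ nashHiZ
  by_cases hMI : m ∈ MI
  · simp only [hMI, if_true]
    push_cast at SA1 SA2 SB1 SB2 L1 L2 ⊢
    constructor <;> nlinarith [SA1, SA2, SB1, SB2, L1, L2]
  · simp only [hMI, if_false]
    push_cast at SB1 SB2 L1 L2 ⊢
    constructor <;> nlinarith [SB1, SB2, L1, L2]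

end Nash

/-! ## §2 The host-force pairing column `hf` -/

/-- ★ THE (251) `hhf` ENTRY in the Gram frame: for the interior label with multiplier `y = ω m` and near differences `z a`
(`a ∈ s`), windows `tlo/thi` of `g(z a, z a)` and intervals `glo/ghi` of `g(y, z a)`, a norm witness `‖posL F y‖ ≤ yb` and rational
dial data `δ, Lh`: `⟪posL F y, Σ_{a∈s} g(posL F (z a))⟫ + ‖posL F y‖·psiTail δ Lh ≤ (Σ_{a∈s} cornerHi … + scHi yb (rdHi S (psiTailQ δ Lh)))/S`. [folklore] -/
theorem hf_le {S : ℤ} (F : Matrix (Fin 3) (Fin 3) ℝ) {α : Type*} (s : Finset α) (y : Fin 3 → ℝ) (z : α → Fin 3 → ℝ)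
    (tlo thi glo ghi : α → ℚ) {yb δ Lh : ℚ} (hS : 0 < S)
    (hw : ∀ a ∈ s, 0 < tlo a ∧ (tlo a : ℝ) ≤ gram (F.transpose * F) (z a) (z a) ∧ gram (F.transpose * F) (z a) (z a) ≤ (thi a : ℝ)
      ∧ (glo a : ℝ) ≤ gram (F.transpose * F) y (z a) ∧ gram (F.transpose * F) y (z a) ≤ (ghi a : ℝ))
    (hyb : ‖posL F y‖ ≤ (yb : ℝ)) (hδ : 0 < δ) (hLh : 0 < Lh) :
    ⟪posL F y, ∑ a ∈ s, ljBondForce (posL F (z a))⟫ + ‖posL F y‖ * psiTail (δ : ℝ) (Lh : ℝ)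
      ≤ ((∑ a ∈ s, cornerHi (psiLoZ S (tlo a) (thi a)) (psiHiZ S (tlo a) (thi a)) (glo a) (ghi a)
          + scHi yb (rdHi S (psiTailQ δ Lh)) : ℤ) : ℝ) / S := by
  refine le_div_of_reading hS ?_
  rw [inner_posL_sum_ljBondForce]
  have h1 : ∀ a ∈ s, S * (psiT (gram (F.transpose * F) (z a) (z a)) * gram (F.transpose * F) y (z a))
      ≤ ((cornerHi (psiLoZ S (tlo a) (thi a)) (psiHiZ S (tlo a) (thi a)) (glo a) (ghi a) : ℤ) : ℝ) := by
    intro a ha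
    obtain ⟨t0, t1, t2, g1, g2⟩ := hw a ha
    exact pairing_le_cornerHi hS t0 t1 t2 g1 g2
  have H1 := le_finsetSum_readings S s _ _ h1
  -- the tail: ‖F y‖·psiTail ≤ yb·psiTail, psiTail read by rdHi
  have hpt := le_psiTailHiZ (S := S) δ Lh
  have hpt0 : 0 ≤ psiTail (δ : ℝ) (Lh : ℝ) := by
    have hδ' : (0 : ℝ) < δ := by exact_mod_cast hδ
    have hL' : (0 : ℝ) < Lh := by exact_mod_cast hLh
    unfold psiTail Summit.AtomisticToContinuum.Crystallization.Theorems.FrustratedLawDichotomyCellTails.S4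
      Summit.AtomisticToContinuum.Crystallization.Theorems.FrustratedLawDichotomyCellTails.S10
    positivity
  have hy : S * (‖posL F y‖ * psiTail (δ : ℝ) (Lh : ℝ)) ≤ S * ((yb : ℝ) * psiTail (δ : ℝ) (Lh : ℝ)) :=
    mul_le_mul_of_nonneg_left (mul_le_mul_of_nonneg_right hyb hpt0) (by exact_mod_cast hS.le)
  have hyb0 : 0 ≤ yb := by
    have : (0 : ℝ) ≤ yb := (norm_nonneg _).trans hyb
    exact_mod_cast this
  have H2 := le_scHi (c := yb) hyb0 hpt
  push_cast at H1 H2 ⊢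
  rw [mul_add]
  linarith

/-! ## §3 The remainder pair term -/

/-- ★ one summand of the (251) `hRM` column: `0 ≤ a ≤ yb` (the norm `‖YE m − YE m'‖` by witness), `rlo ≤ r ≤ rhi` (the bond class),
`0 ≤ η < rlo` (`η = dispL m + dispL m' ∈ {τ, 2τ}`) ⇒ `a·forceRem r η ≤ scHi yb (forceRemHiZ S rlo rhi η)/S`. [folklore] -/
theorem rmTerm_le {S : ℤ} {a r : ℝ} {yb rlo rhi η : ℚ} (hS : 0 < S) (ha0 : 0 ≤ a) (ha : a ≤ (yb : ℝ)) (hη : 0 ≤ η)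
    (hlo : η < rlo) (h1 : (rlo : ℝ) ≤ r) (h2 : r ≤ (rhi : ℝ)) :
    a * forceRem r (η : ℝ) ≤ ((scHi yb (forceRemHiZ S rlo rhi η) : ℤ) : ℝ) / S := by
  refine le_div_of_reading hS ?_
  have hf := le_forceRemHiZ (r := r) hS hη hlo h1 h2
  have hf0 : 0 ≤ forceRem r (η : ℝ) := by
    have hr : (η : ℝ) < r := lt_of_lt_of_le (by exact_mod_cast hlo) h1
    exact Summit.AtomisticToContinuum.Crystallization.Theorems.FrustratedLawDichotomyCertFloorTailsRem.forceRem_nonneg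
      (le_of_lt (lt_of_le_of_lt (by exact_mod_cast hη) hr)) (by exact_mod_cast hη)
  have hyb0 : 0 ≤ yb := by
    have : (0 : ℝ) ≤ yb := ha0.trans ha
    exact_mod_cast this
  have H := le_scHi (c := yb) hyb0 hf
  have hy : S * (a * forceRem r (η : ℝ)) ≤ S * ((yb : ℝ) * forceRem r (η : ℝ)) :=
    mul_le_mul_of_nonneg_left (mul_le_mul_of_nonneg_right ha hf0) (by exact_mod_cast hS.le)
  exact hy.trans H

end Summit.AtomisticToContinuum.Crystallization.Theorems.FrustratedLawDichotomyCellArithNash
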